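import Summits.CriticalPhenomena.PercolationContinuityZ3.Theses.PercMonotoneFactors
import Literature.Probability.Percolation.SharpnessDCTProofs
import HarnessLib

/-!
# Crux `MesoscopicGluing` (stmt-CriticalPhenomena-18047) — birth skeleton (BC3)

Line `birth`: MESOSCOPIC GLUING from a quantitative LOCAL TWO-ARM BOUND.  The gluing event `G_n`
fails only if some `u ∈ Λ_{2n}` carries a "two-arm failure": an `n`-far-connected `u'` within `3m`
of the `n`-far-connected `u`, not joined to it inside `Λ_{4n}(u) ⊆ Λ_{6n}`.  Two stubs:

* `stub_localTwoArmRate` (the heart; open at a percolating threshold even for `F = id`): wherever a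
  class member percolates, the two-arm failure AT THE ORIGIN has probability `≤ C n⁻⁴`;
* `stub_shiftInvariance` (provable now, M): the block-factor law `μ_t^F` and the two-arm failure
  event are translation covariant, so the failure probability at `u` equals that at `0`.

Composition `MesoscopicGluing_of` (proved here): union bound over the `(4n+1)³` points of `Λ_{2n}`,
`μ(G_nᶜ) ≤ (4n+1)³ C n⁻⁴ ≤ 125 C / n → 0`, locality (measurability) of `G_n`, squeeze.
-/

noncomputable section

namespace Summit.CriticalPhenomena.PercolationContinuityZ3.Cruxes.MesoscopicGluing.Birth

open MeasureTheory Filter Topology Set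
open Literature.Probability.Percolation Literature.Probability.LatticeModels
open Summit.CriticalPhenomena.PercolationContinuityZ3.Theses.PercMonotoneFactors

/-! ### Stubs -/

/-- STUB (rank 1, the heart of the line): **local two-arm bound with a polynomial rate.** Wherever
an admissible `F` percolates at `t`, the probability that the origin is `n`-far-connected, some
`u'` within `3(⌊√n⌋+1)` of it is `n`-far-connected, and the two are NOT joined inside `Λ_{4n}`,
is `≤ C n⁻⁴`.  Supercritical `F = id`: exponentially small (Antal–Pisztora).  At a percolating
threshold: open. -/
theorem stub_localTwoArmRate :
    ∀ (R : ℕ) (F : BondConfig (Site 3) → BondConfig (Site 3)), Measurable F → Monotone F → F ∅ = ∅ → F (zdGraph 3).edgeSet = (zdGraph 3).edgeSet → (∀ ω : BondConfig (Site 3), ω ⊆ (zdGraph 3).edgeSet → F ω ⊆ (zdGraph 3).edgeSet) → (∀ (φ : zdGraph 3 ≃g zdGraph 3) (ω : BondConfig (Site 3)), F (Sym2.map φ '' ω) = Sym2.map φ '' (F ω)) → (∀ (ω ω' : BondConfig (Site 3)) (e : Sym2 (Site 3)), (∀ e' : Sym2 (Site 3), (∃ x ∈ e, ∃ y ∈ e',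 ∀ i, |x i - y i| ≤ (R : ℤ)) → (e' ∈ ω ↔ e' ∈ ω')) → (e ∈ F ω ↔ e ∈ F ω')) → ∀ t : unitInterval, 0 < ((bondPercolation (zdGraph 3) t).map F).real (percolatesAt 0) → ∃ C : ℝ, ∀ n : ℕ, 1 ≤ n → ((bondPercolation (zdGraph 3) t).map F).real {ω : BondConfig (Site 3) | ∃ u' : Site 3, (∀ i, |u' i - (0 : Site 3) i| ≤ 3 * ((Nat.sqrt n + 1 : ℕ) : ℤ)) ∧ (∃ y : Site 3, (∃ i, |y i - (0 : Site 3) i| = (n : ℤ)) ∧ ω ∈ openConnIn {z : Site 3 | ∀ i, |z i - (0 : Site 3) i| ≤ (n : ℤ)} (0 : Site 3) y) ∧ (∃ y : Site 3, (∃ i, |y i - u' i| = (n : ℤ)) ∧ ω ∈ openConnIn {z : Site 3 | ∀ i, |z i - u' i| ≤ (n : ℤ)} u' y) ∧ ω ∉ openConnIn {z : Site 3 | ∀ i, |z i - (0 : Site 3) i| ≤ 4 * (n : ℤ)} (0 : Site 3) u'} ≤ C / (n : ℝ) ^ 4 := by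
  sorry

/-- STUB (rank 2, provable now): **translation covariance.** The two-arm failure probability around
`u` equals the one around the origin: `μ_t^F` is invariant under lattice translations (`F` is
`Aut(ℤ³)`-equivariant, `P_t` is translation invariant) and the event around `u` is the translate
of the event around `0`. -/
theorem stub_shiftInvariance :
    ∀ (R : ℕ) (F : BondConfig (Site 3) → BondConfig (Site 3)), Measurable F → Monotone F → F ∅ = ∅ → F (zdGraph 3).edgeSet = (zdGraph 3).edgeSet → (∀ ω : BondConfig (Site 3), ω ⊆ (zdGraph 3).edgeSet → F ω ⊆ (zdGraph 3).edgeSet) → (∀ (φ : zdGraph 3 ≃g zdGraph 3) (ω : BondConfig (Site 3)), F (Sym2.map φ '' ω) = Sym2.map φ '' (F ω)) → (∀ (ω ω' : BondConfig (Site 3)) (e : Sym2 (Site 3)), (∀ e' : Sym2 (Site 3), (∃ x ∈ e, ∃ y ∈ e', ∀ i, |x i - y i| ≤ (R : ℤ)) → (e' ∈ ω ↔ e' ∈ ω')) → (e ∈ F ω ↔ e ∈ F ω')) → ∀ t : unitInterval, ∀ (n : ℕ) (u : Site 3), ((bondPercolation (zdGraph 3) t).map F).real {ω : BondConfig (Site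 3) | ∃ u' : Site 3, (∀ i, |u' i - u i| ≤ 3 * ((Nat.sqrt n + 1 : ℕ) : ℤ)) ∧ (∃ y : Site 3, (∃ i, |y i - u i| = (n : ℤ)) ∧ ω ∈ openConnIn {z : Site 3 | ∀ i, |z i - u i| ≤ (n : ℤ)} u y) ∧ (∃ y : Site 3, (∃ i, |y i - u' i| = (n : ℤ)) ∧ ω ∈ openConnIn {z : Site 3 | ∀ i, |z i - u' i| ≤ (n : ℤ)} u' y) ∧ ω ∉ openConnIn {z : Site 3 | ∀ i, |z i - u i| ≤ 4 * (n : ℤ)} u u'} = ((bondPercolation (zdGraph 3) t).map F).real {ω : BondConfig (Site 3) | ∃ u' : Site 3, (∀ i, |u' i - (0 : Site 3) i| ≤ 3 * ((Nat.sqrt n + 1 : ℕ) : ℤ)) ∧ (∃ y : Site 3, (∃ i, |y i - (0 : Site 3) i| = (n : ℤ)) ∧ ω ∈ openConnIn {z : Site 3 | ∀ i, |z i - (0 : Site 3) i| ≤ (n : ℤ)} (0 : Site 3) y) ∧ (∃ y : Site 3, (∃ i, |y i - u' i| = (n : ℤ)) ∧ ω ∈ openConnIn {z : Site 3 | ∀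 i, |z i - u' i| ≤ (n : ℤ)} u' y) ∧ ω ∉ openConnIn {z : Site 3 | ∀ i, |z i - (0 : Site 3) i| ≤ 4 * (n : ℤ)} (0 : Site 3) u'} := by
  sorry

/-! ### Tools for the composition -/

/-- `{x ⟷ y in S}` is monotone in `S` (copy of `RSW.openConnIn_mono`). [folklore] -/
theorem openConnIn_mono' {V : Type*} {S S' : Set V} (h : S ⊆ S') (x y : V) :
    (openConnIn S x y : Set (BondConfig V)) ⊆ openConnIn S' x y := by
  rintro ω ⟨hx, hy, hr⟩
  exact ⟨h hx, h hy, hr.map (SimpleGraph.induceHomOfLE (G := openGraph ω) h).toHom⟩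

/-- The cube `Λ_m` of `ℤ³` is finite. [folklore] -/
theorem finite_cube (m : ℤ) : {z : Site 3 | ∀ i, |z i| ≤ m}.Finite :=
  (Set.finite_Icc (fun _ => -m) (fun _ => m)).subset fun z (hz : ∀ i, |z i| ≤ m) =>
    ⟨fun i => (abs_le.1 (hz i)).1, fun i => (abs_le.1 (hz i)).2⟩

/-- The gluing event `G_n` is determined by the pairs of `Λ_{6n}` (local event). [folklore] -/
theorem determinedBy_gluingEvent (n : ℕ) :
    DeterminedBy {ω : BondConfig (Site 3) | ∀ u u' : Site 3, (∀ i, |u i| ≤ 2 * (n : ℤ)) → (∀ i, |u' i| ≤ 2 * (n : ℤ)) → (∀ i, |u i - u' i| ≤ 3 * ((Nat.sqrt n + 1 : ℕ) : ℤ)) → (∃ y : Site 3, (∃ i, |y i - u i| = (n : ℤ)) ∧ ω ∈ openConnIn {z : Site 3 | ∀ i, |z i - u i| ≤ (n : ℤ)} u y) → (∃ y : Site 3, (∃ i, |y i - u' i| = (n : ℤ)) ∧ ω ∈ openConnIn {z : Site 3 | ∀ i, |z i - u' i| ≤ (n : ℤ)} u' y) → ω ∈ openConnIn {z : Site 3 |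 ∀ i, |z i| ≤ 6 * (n : ℤ)} u u'}
      {z : Site 3 | ∀ i, |z i| ≤ 6 * (n : ℤ)}.sym2 := by
  rw [determinedBy_iff]
  intro ω ω' h
  have hsub : ∀ u : Site 3, (∀ i, |u i| ≤ 2 * (n : ℤ)) →
      {z : Site 3 | ∀ i, |z i - u i| ≤ (n : ℤ)}.sym2 ⊆ {z : Site 3 | ∀ i, |z i| ≤ 6 * (n : ℤ)}.sym2 := by
    intro u hu e he
    rw [Set.mem_sym2_iff_subset] at he ⊢
    intro z hz
    have h1 : ∀ i, |z i - u i| ≤ (n : ℤ) := he hz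
    show ∀ i, |z i| ≤ 6 * (n : ℤ)
    intro i
    have h1 := h1 i
    have h2 := hu i
    have hn0 : (0 : ℤ) ≤ n := Int.natCast_nonneg n
    rw [abs_le] at h1 h2 ⊢
    constructor <;> linarith [h1.1, h1.2, h2.1, h2.2]
  have hiff : ∀ u : Site 3, (∀ i, |u i| ≤ 2 * (n : ℤ)) → ∀ y : Site 3,
      (ω ∈ openConnIn {z : Site 3 | ∀ i, |z i - u i| ≤ (n : ℤ)} u y ↔
        ω' ∈ openConnIn {z : Site 3 | ∀ i, |z i - u i| ≤ (n : ℤ)} u y) :=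
    fun u hu y => (determinedBy_iff _ _).1
      (DCT16.determinedBy_openConnIn _ u y (hsub u hu)) ω ω' h
  have hiff6 : ∀ u u' : Site 3,
      (ω ∈ openConnIn {z : Site 3 | ∀ i, |z i| ≤ 6 * (n : ℤ)} u u' ↔
        ω' ∈ openConnIn {z : Site 3 | ∀ i, |z i| ≤ 6 * (n : ℤ)} u u') :=
    fun u u' => (determinedBy_iff _ _).1
      (DCT16.determinedBy_openConnIn _ u u' subset_rfl) ω ω' h
  simp only [Set.mem_setOf_eq]
  exact forall_congr' fun u => forall_congr' fun u' =>
    imp_congr_right fun hu => imp_congr_right fun hu' => imp_congr_right fun _ =>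
      imp_congr (exists_congr fun y => and_congr_right fun _ => hiff u hu y)
        (imp_congr (exists_congr fun y => and_congr_right fun _ => hiff u' hu' y) (hiff6 u u'))

/-- `G_n` is measurable. [folklore] -/
theorem measurableSet_gluingEvent (n : ℕ) :
    MeasurableSet {ω : BondConfig (Site 3) | ∀ u u' : Site 3, (∀ i, |u i| ≤ 2 * (n : ℤ)) → (∀ i, |u' i| ≤ 2 * (n : ℤ)) → (∀ i, |u i - u' i| ≤ 3 * ((Nat.sqrt n + 1 : ℕ) : ℤ)) → (∃ y : Site 3, (∃ i, |y i - u i| = (n : ℤ)) ∧ ω ∈ openConnIn {z : Site 3 | ∀ i, |z i - u i| ≤ (n : ℤ)} u y) → (∃ y : Site 3, (∃ i, |y i - u' i| = (n : ℤ)) ∧ ω ∈ openConnIn {z : Site 3 | ∀ i, |z i - u' i| ≤ (n : ℤ)} u' y) → ω ∈ openConnIn {z : Site 3 | ∀ i, |z i| ≤ 6 * (n : ℤ)} u u'} := by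
  classical
  have hSfin : ({z : Site 3 | ∀ i, |z i| ≤ 6 * (n : ℤ)}).Finite := finite_cube _
  have h' : DeterminedBy {ω : BondConfig (Site 3) | ∀ u u' : Site 3, (∀ i, |u i| ≤ 2 * (n : ℤ)) → (∀ i, |u' i| ≤ 2 * (n : ℤ)) → (∀ i, |u i - u' i| ≤ 3 * ((Nat.sqrt n + 1 : ℕ) : ℤ)) → (∃ y : Site 3, (∃ i, |y i - u i| = (n : ℤ)) ∧ ω ∈ openConnIn {z : Site 3 | ∀ i, |z i - u i| ≤ (n : ℤ)} u y) → (∃ y : Site 3, (∃ i, |y i - u' i| = (n : ℤ)) ∧ ω ∈ openConnIn {z : Site 3 | ∀ i, |z i - u' i| ≤ (n : ℤ)} u' y) → ω ∈ openConnIn {z : Site 3 | ∀ i, |z i| ≤ 6 * (n : ℤ)} u u'} ↑(hSfin.toFinset.sym2) := by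
    rw [Finset.coe_sym2, hSfin.coe_toFinset]
    exact determinedBy_gluingEvent n
  exact h'.measurableSet_of_finset

/-- The number of lattice points of `Λ_{2n}` is `(4n+1)³`. [folklore] -/
theorem card_box (n : ℕ) :
    ((Finset.Icc (fun _ : Fin 3 => -(2 * (n : ℤ))) (fun _ => 2 * (n : ℤ))).card : ℝ) =
      ((4 * n + 1 : ℕ) : ℝ) ^ 3 := by
  rw [Pi.card_Icc]
  simp only [Int.card_Icc, Finset.prod_const, Finset.card_univ, Fintype.card_fin]
  have : (2 * (n : ℤ) + 1 - -(2 * (n : ℤ))).toNat = 4 * n + 1 := by omega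
  rw [this]
  push_cast
  ring

/-! ### Composition -/

/-- **Union bound** (abstract): if `A ⊆ ⋃_{u ∈ s} T u` and each `μ(T u) ≤ c`, then
`μ(A) ≤ |s| · c`. [folklore] -/
theorem measureReal_le_card_mul {X ι : Type*} [MeasurableSpace X] (μ : Measure X) [IsFiniteMeasure μ]
    (s : Finset ι) (T : ι → Set X) (A : Set X) (h : A ⊆ ⋃ u ∈ s, T u) (c : ℝ)
    (hT : ∀ u ∈ s, μ.real (T u) ≤ c) : μ.real A ≤ (s.card : ℝ) * c := by
  calc μ.real A ≤ μ.real (⋃ u ∈ s, T u) := measureReal_mono h (measure_ne_top μ _)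
    _ ≤ ∑ u ∈ s, μ.real (T u) := measureReal_biUnion_finset_le _ _
    _ ≤ ∑ _u ∈ s, c := Finset.sum_le_sum hT
    _ = (s.card : ℝ) * c := by rw [Finset.sum_const, nsmul_eq_mul]

/-- **Squeeze** (abstract): if the complements of measurable events `G_n` have probability
`≤ a_n → 0`, then `μ(G_n) → 1`. [folklore] -/
theorem tendsto_one_of_compl_le {X : Type*} [MeasurableSpace X] (μ : Measure X)
    [IsProbabilityMeasure μ] (G : ℕ → Set X) (hGm : ∀ n, MeasurableSet (G n)) (a : ℕ → ℝ)
    (ha : Tendsto a atTop (𝓝 0)) (h : ∀ᶠ n in atTop, μ.real (G n)ᶜ ≤ a n) :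
    Tendsto (fun n => μ.real (G n)) atTop (𝓝 1) := by
  have hlow : Tendsto (fun n => 1 - a n) atTop (𝓝 1) := by simpa using ha.const_sub 1
  refine tendsto_of_tendsto_of_tendsto_of_le_of_le' hlow tendsto_const_nhds ?_
    (Eventually.of_forall fun n => measureReal_le_one)
  filter_upwards [h] with n hn
  have hcompl := measureReal_compl (μ := μ) (hGm n)
  rw [probReal_univ] at hcompl
  linarith

/-- `(4n+1)³ · C n⁻⁴ ≤ 125 C / n` for `n ≥ 1`, `C ≥ 0`. [folklore] -/
theorem rate_bound {C : ℝ} (hC0 : 0 ≤ C) (n : ℕ) (hn : 1 ≤ n) :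
    ((4 * n + 1 : ℕ) : ℝ) ^ 3 * (C / (n : ℝ) ^ 4) ≤ 125 * C / (n : ℝ) := by
  have hn' : (1 : ℝ) ≤ n := by exact_mod_cast hn
  have hnpos : (0 : ℝ) < n := by linarith
  have h45 : ((4 * n + 1 : ℕ) : ℝ) ^ 3 ≤ 125 * (n : ℝ) ^ 3 := by
    have : ((4 * n + 1 : ℕ) : ℝ) ≤ 5 * (n : ℝ) := by push_cast; linarith
    calc ((4 * n + 1 : ℕ) : ℝ) ^ 3 ≤ (5 * (n : ℝ)) ^ 3 := by gcongr
      _ = 125 * (n : ℝ) ^ 3 := by ring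
  calc ((4 * n + 1 : ℕ) : ℝ) ^ 3 * (C / (n : ℝ) ^ 4)
      ≤ 125 * (n : ℝ) ^ 3 * (C / (n : ℝ) ^ 4) := by gcongr
    _ = 125 * C / (n : ℝ) := by field_simp

/-- **Deterministic reduction**: a failure of the gluing event `G_n` at a pair `(u, u')` of
`Λ_{2n}` is a two-arm failure around `u` (since `Λ_{4n}(u) ⊆ Λ_{6n}`). [folklore] -/
theorem compl_gluing_subset (n : ℕ) :
    {ω : BondConfig (Site 3) | ∀ u u' : Site 3, (∀ i, |u i| ≤ 2 * (n : ℤ)) → (∀ i, |u' i| ≤ 2 * (n : ℤ)) → (∀ i, |u i - u' i| ≤ 3 * ((Nat.sqrt n + 1 : ℕ) : ℤ)) → (∃ y : Site 3, (∃ i, |y i - u i| = (n : ℤ)) ∧ ω ∈ openConnIn {z : Site 3 | ∀ i, |z i - u i| ≤ (n : ℤ)} u y) → (∃ y : Site 3, (∃ i, |y i - u' i| = (n : ℤ)) ∧ ω ∈ openConnIn {z : Site 3 | ∀ i, |z i - u' i| ≤ (n : ℤ)} u' y) → ω ∈ openConnIn {z : Site 3 | ∀ i, |z i| ≤ 6 *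 (n : ℤ)} u u'}ᶜ ⊆
      ⋃ u ∈ Finset.Icc (fun _ : Fin 3 => -(2 * (n : ℤ))) (fun _ => 2 * (n : ℤ)),
        {ω : BondConfig (Site 3) | ∃ u' : Site 3, (∀ i, |u' i - u i| ≤ 3 * ((Nat.sqrt n + 1 : ℕ) : ℤ)) ∧ (∃ y : Site 3, (∃ i, |y i - u i| = (n : ℤ)) ∧ ω ∈ openConnIn {z : Site 3 | ∀ i, |z i - u i| ≤ (n : ℤ)} u y) ∧ (∃ y : Site 3, (∃ i, |y i - u' i| = (n : ℤ)) ∧ ω ∈ openConnIn {z : Site 3 | ∀ i, |z i - u' i| ≤ (n : ℤ)} u' y) ∧ ω ∉ openConnIn {z : Site 3 | ∀ i, |z i - u i| ≤ 4 * (n : ℤ)} u u'} := by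
  intro ω hω
  rw [Set.mem_compl_iff, Set.mem_setOf_eq] at hω
  obtain ⟨u, hω⟩ := not_forall.1 hω
  obtain ⟨u', hω⟩ := not_forall.1 hω
  obtain ⟨hu, hω⟩ := Classical.not_imp.1 hω
  obtain ⟨hu', hω⟩ := Classical.not_imp.1 hω
  obtain ⟨hclose, hω⟩ := Classical.not_imp.1 hω
  obtain ⟨hFu, hω⟩ := Classical.not_imp.1 hω
  obtain ⟨hFu', hnot⟩ := Classical.not_imp.1 hω
  have hub : u ∈ Finset.Icc (fun _ : Fin 3 => -(2 * (n : ℤ))) (fun _ => 2 * (n : ℤ)) := by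
    rw [Finset.mem_Icc]
    exact ⟨fun i => (abs_le.1 (hu i)).1, fun i => (abs_le.1 (hu i)).2⟩
  have h46 : {z : Site 3 | ∀ i, |z i - u i| ≤ 4 * (n : ℤ)} ⊆ {z : Site 3 | ∀ i, |z i| ≤ 6 * (n : ℤ)} := by
    intro z hz i
    have h1 := abs_le.1 (hz i)
    have h2 := abs_le.1 (hu i)
    rw [abs_le]; constructor <;> linarith [h1.1, h1.2, h2.1, h2.2]
  refine Set.mem_iUnion₂.2 ⟨u, hub, ?_⟩
  exact ⟨u', fun i => by rw [abs_sub_comm]; exact hclose i, hFu, hFu',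
    fun hin => hnot (openConnIn_mono' h46 u u' hin)⟩

/-- **`MesoscopicGluing` from the two stubs**: union bound over `Λ_{2n}`, shift invariance,
`(4n+1)³ · C n⁻⁴ ≤ 125 C / n → 0`, and `μ(G_n) = 1 - μ(G_nᶜ)` (`G_n` is local). -/
theorem MesoscopicGluing_of : MesoscopicGluing := by
  intro R F hFm hFmono hF0 hFE hFsub hFeq hloc t hpos
  obtain ⟨C, hC⟩ := stub_localTwoArmRate R F hFm hFmono hF0 hFE hFsub hFeq hloc t hpos
  have hshift := stub_shiftInvariance R F hFm hFmono hF0 hFE hFsub hFeq hloc t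
  haveI : IsProbabilityMeasure ((bondPercolation (zdGraph 3) t).map F) :=
    Measure.isProbabilityMeasure_map hFm.aemeasurable
  have hC0 : 0 ≤ C := by
    have := hC 1 le_rfl
    simp only [Nat.cast_one, one_pow, div_one] at this
    exact measureReal_nonneg.trans this
  refine tendsto_one_of_compl_le ((bondPercolation (zdGraph 3) t).map F) _
    (fun n => measurableSet_gluingEvent n) (fun n => 125 * C / (n : ℝ))
    (tendsto_const_div_atTop_nhds_zero_nat (125 * C)) ?_
  filter_upwards [eventually_ge_atTop 1] with n hn
  refine ((measureReal_le_card_mul ((bondPercolation (zdGraph 3) t).map F) _ _ _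
    (compl_gluing_subset n) (C / (n : ℝ) ^ 4) fun u _ => (hshift n u).le.trans (hC n hn)).trans ?_)
  rw [card_box n]
  exact rate_bound hC0 n hn

end Summit.CriticalPhenomena.PercolationContinuityZ3.Cruxes.MesoscopicGluing.Birth
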